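import Summits.QuantumFields.YangMills.Theorems.PoincareLipschitzSphereMapSmallRangeTwistedLetters
import HarnessLib

/-!
# Line «poincare_lipschitz» on crux `HistoryTailL` (stmt-QuantumFields-19936), route crux `BlockLipschitzL` (stmt-QuantumFields-23533), K2 organ of record `hReg` (LOC-REG-MIN) —
# «SMALL-RANGE-τ» FILE 1: THE TWISTED TWIN OF ✓`PoincareLipschitzSphereMapSmallRangeCaccioppoli` — one-site-optimal sphere-valued lattice maps FOR A CONNECTION BY LINEAR
# ISOMETRIES `τ` ((V, τ) letters of ✓`PoincareLipschitzCovariantCaccioppoli`): (I1)_τ exact, and the SMALL-RANGE CACCIOPPOLI INEQUALITY WITH TWIST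
# `E_τ(Q_ρ(z)) ≤ #Q_{ρ+s+1}(z)·(448·d·(ω+τ₀)²∕s² + 96·d·(ω+τ₀)·τ₀∕s + 16·τ₁ + 704·d·τ₀²)` — `τ₀` the sup defect of `τ`, `τ₁` its divergence defect

Cell `ym3-torus` (YM ladder rung R3 = continuum SU(2) Yang–Mills on the three-torus — a RUNG, NOT the Clay problem); width seat `ym3-torus-px7` gen 5 (LEAD ym-ust-19936-w1 g8
05:09:09Z (1): «the `hReg` consumer is TWISTED — carry bond isometries as a letter with a defect; flat = identity; every estimate picks up `+ C·τ·(…)`»; my 05:16Z call «twisted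
twin by px7»).  THEOREMS ONLY (def-free) over FILE 1 (the `τ ≡ refl` instance) and lit ✓`exists_cutoff`∕✓`sum_mul_lop`∕✓`sum_box_shift_of_support`; `--supports stmt-QuantumFields-19936`.
Nothing here proves `hReg`, the per-bond charts, a stub, `BlockLipschitzL`, `HistoryTailL` or a summit statement.

LETTERS.  `τ : Fin d → ℤ^d → (V ≃ₗᵢ[ℝ] V)` (`τ μ y` transports the fibre at `y + e_μ` to the fibre at `y`), `D_μu(y) = τ μ y (u(y+e_μ)) − u(y)`, TWISTED NEIGHBOUR SUM
`N(y) = Σ_μ (τ μ y (u(y+e_μ)) + (τ μ (y−e_μ))⁻¹(u(y−e_μ)))`, one-site optimality `‖N(y)‖·u(y) = N(y)`, `λ_τ(y) = Σ_μ ((1 − ⟪u y, τ μ y (u(y+e_μ))⟫) + (1 − ⟪u y, (τ μ (y−e_μ))⁻¹(u(y−e_μ))⟫))`;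
TWO DISPLAYED DEFECTS on the box: SUP `‖τ μ y v − v‖ ≤ τ₀‖v‖` (radial gauge: `τ₀ ≲ θ·r`) and DIVERGENCE `‖Σ_μ ((τ μ y v − v) + ((τ μ (y−e_μ))⁻¹ v − v))‖ ≤ τ₁‖v‖` (radial
gauge: `τ₁ ≲ θ`), so the conclusion reads `E_τ(Q_ρ) ≲_d ρ^{d−2}(ω+τ₀)² + ρ^{d−1}(ω+τ₀)τ₀ + ρ^d(τ₁ + τ₀²) ≍ ρ^{d−2}ω² + θ·ρ^d·(1 + ω + θρ²)` — the `(R⁻¹-part, θR²-part)` split of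
`hReg`'s radius law at the energy level.  Against the flat file: (I1)_τ is EXACT (isometry); the test function is still the FLAT `g = 1 − ⟪u,p⟫` (flat summation by parts,
flat Gauss-map trick `|∂_μg| ≤ ω‖u(y+e_μ) − u(y)‖ ≤ ω(‖D_μu(y)‖ + τ₀)`); the one new object is the TWIST SOURCE `T(y) = Σ_μ ((τ μ y − 1)u(y+e_μ) + ((τ μ (y−e_μ))⁻¹ − 1)u(y−e_μ))`
in `−Δg = −λ_τ⟪u,p⟫ − ⟪T,p⟫`, of size `≤ τ₁ + τ₀·Σ_μ(‖D_μu(y)‖ + ‖D_μu(y−e_μ)‖ + 2τ₀)`, its backward half re-indexed (✓`sum_box_shift_of_support`) and absorbed by Young.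

* ★★ `smallRange_caccioppoli_twisted` — the title, over FILE 1a ✓`PoincareLipschitzSphereMapSmallRangeTwistedLetters` ((I1)_τ, twist source, real lemmas); decl-local
  `maxHeartbeats 400000` (RULES: one long absorption argument).
[folklore] ([Giaquinta1984] Ch. VI §1 Thm 1.1 step I, §3 Thm 3.2 with a metric connection; [Balaban1985BackgroundPropagators] (3.8), (3.23) pp.392–394 — covariant lattice letters).
-/

set_option autoImplicit false

noncomputable section

open scoped BigOperators InnerProductSpace
open Finset

namespace Summit.QuantumFields.YangMills.Theorems.PoincareLipschitzSphereMapSmallRangeCaccioppoliTwisted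

open Literature.MathematicalPhysics.QuantumFieldTheory.Balaban1983to89
open B4Eq19LatticeOperators
open B4Eq19LatticeCaccioppoli (exists_cutoff)
open Summit.QuantumFields.YangMills.Theorems.PoincareLipschitzSphereMapSmallRangeCaccioppoli
  (one_sub_inner_eq one_sub_inner_nonneg abs_sub_oneSubInner_le inner_ge_half bond_young_le)
open Summit.QuantumFields.YangMills.Theorems.PoincareLipschitzSphereMapSmallRangeTwistedLetters

variable {d : ℕ} {V : Type*} [NormedAddCommGroup V] [InnerProductSpace ℝ V]

/-! ## ★★ The small-range Caccioppoli inequality with twist -/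

set_option maxHeartbeats 400000 in
/-- ★★ **THE SMALL-RANGE CACCIOPPOLI INEQUALITY WITH TWIST.**  `d ≥ 1`, `ρ ≥ 0`, `s ≥ 1`; `τ` a connection by linear isometries with sup defect `τ₀ ≥ 0` and
divergence defect `τ₁ ≥ 0` on `Q_{ρ+s+2}(z)`; `u : ℤ^d → V` with `‖u‖ = 1` and `‖u − p‖ ≤ ω` on `Q_{ρ+s+2}(z)` (`‖p‖ = 1`, `0 ≤ ω`, `ω + τ₀ ≤ 1`), twisted one-site optimal on
`Q_{ρ+s+1}(z)`.  Then the covariant forward energy obeys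
`Σ_{y∈Q_ρ(z)} Σ_μ ‖τ μ y (u(y+e_μ)) − u(y)‖² ≤ #Q_{ρ+s+1}(z)·(448·d·(ω+τ₀)²∕s² + 96·d·(ω+τ₀)·τ₀∕s + 16·τ₁ + 704·d·τ₀²)`, `#Q_{ρ+s+1} = (2(ρ+s+1)+1)^d`;
at `s = ρ+1` and in a radial gauge (`τ₀ ≲ θρ`, `τ₁ ≲ θ`): `E_τ(Q_ρ) ≲_d ρ^{d−2}ω² + θρ^d(1 + ω + θρ²)`.  `τ ≡ refl` (`τ₀ = τ₁ = 0`) is ✓`smallRange_caccioppoli` up to constants.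
[folklore] [cite: Giaquinta1984, Ch. VI §1 Thm 1.1 step I p.128, §3 Thm 3.2 p.137; Balaban1985BackgroundPropagators, (3.23)-(3.25) p.394] -/
theorem smallRange_caccioppoli_twisted (hd : 1 ≤ d) (τ : Fin d → Zd d → (V ≃ₗᵢ[ℝ] V)) (u : Zd d → V) (p : V) (hp : ‖p‖ = 1) (z : Zd d)
    {ρ s : ℤ} (hρ : 0 ≤ ρ) (hs : 1 ≤ s) {ω τ₀ τ₁ : ℝ} (hω0 : 0 ≤ ω) (hτ₀ : 0 ≤ τ₀) (hτ₁ : 0 ≤ τ₁) (hωτ : ω + τ₀ ≤ 1)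
    (hu1 : ∀ y ∈ box z (ρ + s + 2), ‖u y‖ = 1) (hω : ∀ y ∈ box z (ρ + s + 2), ‖u y - p‖ ≤ ω)
    (hdef : ∀ y ∈ box z (ρ + s + 2), ∀ μ v, ‖τ μ y v - v‖ ≤ τ₀ * ‖v‖)
    (hdiv : ∀ y ∈ box z (ρ + s + 1), ∀ v : V, ‖∑ μ, ((τ μ y v - v) + ((τ μ (y - unitVec μ)).symm v - v))‖ ≤ τ₁ * ‖v‖)
    (hopt : ∀ y ∈ box z (ρ + s + 1),
      ‖∑ μ, (τ μ y (u (y + unitVec μ)) + (τ μ (y - unitVec μ)).symm (u (y - unitVec μ)))‖ • u y =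
        ∑ μ, (τ μ y (u (y + unitVec μ)) + (τ μ (y - unitVec μ)).symm (u (y - unitVec μ)))) :
    ∑ y ∈ box z ρ, ∑ μ, ‖τ μ y (u (y + unitVec μ)) - u y‖ ^ 2 ≤
      ((2 * (ρ + s + 1) + 1 : ℤ) : ℝ) ^ d *
        (448 * d * (ω + τ₀) ^ 2 / (s : ℝ) ^ 2 + 96 * d * ((ω + τ₀) * τ₀) / s + 16 * τ₁ + 704 * d * τ₀ ^ 2) := by
  classical
  obtain ⟨χ, hχ0, hχ1, hχin, hχout, hχlip⟩ := exists_cutoff z hρ hs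
  set R : ℤ := ρ + s + 1 with hR
  have hs0 : (0 : ℝ) < s := by exact_mod_cast (show (0 : ℤ) < s by linarith)
  have hs1 : (1 : ℝ) ≤ s := by exact_mod_cast hs
  have hdR : (1 : ℝ) ≤ d := by exact_mod_cast hd
  set ω' : ℝ := ω + τ₀ with hω'
  have hω'0 : 0 ≤ ω' := by positivity
  have hωω' : ω ≤ ω' := by linarith
  set g : Zd d → ℝ := fun y => 1 - ⟪u y, p⟫_ℝ with hg
  set lam : Zd d → ℝ := fun y => ∑ μ, ((1 - ⟪u y, τ μ y (u (y + unitVec μ))⟫_ℝ) + (1 - ⟪u y, (τ μ (y - unitVec μ)).symm (u (y - unitVec μ))⟫_ℝ))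
    with hlam
  set Tw : Zd d → V := fun y => ∑ μ, ((τ μ y (u (y + unitVec μ)) - u (y + unitVec μ)) + ((τ μ (y - unitVec μ)).symm (u (y - unitVec μ)) - u (y - unitVec μ)))
    with hTw
  set φ : Zd d → ℝ := fun y => χ y ^ 2 with hφ
  set D : Zd d → Fin d → ℝ := fun y μ => ‖τ μ y (u (y + unitVec μ)) - u y‖ with hD
  set F : ℝ := ∑ y ∈ box z R, χ y ^ 2 * ∑ μ, D y μ ^ 2 with hF
  have hDnn : ∀ y μ, 0 ≤ D y μ := fun _ _ => norm_nonneg _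
  have hRsub1 : box z R ⊆ box z (ρ + s + 1) := by rw [hR]
  have hmem2 : ∀ y ∈ box z R, y ∈ box z (ρ + s + 2) := fun y hy => box_mono z (by rw [hR]; linarith) hy
  have hmem2p : ∀ y ∈ box z R, ∀ μ, y + unitVec μ ∈ box z (ρ + s + 2) := fun y hy μ => by
    have := add_unitVec_mem_box hy μ; rw [hR] at this; simpa [add_assoc] using this
  have hmem2m : ∀ y ∈ box z R, ∀ μ, y - unitVec μ ∈ box z (ρ + s + 2) := fun y hy μ => by
    have := sub_unitVec_mem_box hy μ; rw [hR] at this; simpa [add_assoc] using this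
  have hφ0 : ∀ y ∉ box z (R - 1), φ y = 0 := fun y hy => by
    have : χ y = 0 := hχout y (by rw [hR] at hy; simpa using hy)
    simp [hφ, this]
  have hχ0R : ∀ y ∉ box z (R - 1), χ y = 0 := fun y hy => hχout y (by rw [hR] at hy; simpa using hy)
  have hD2 : ∀ y ∈ box z R, ∀ μ, D y μ ≤ 2 * ω' := by
    intro y hy μ
    have h1 : ‖τ μ y (u (y + unitVec μ)) - u (y + unitVec μ)‖ ≤ τ₀ := by
      have := hdef y (hmem2 y hy) μ (u (y + unitVec μ)); rwa [hu1 _ (hmem2p y hy μ), mul_one] at this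
    calc D y μ = ‖(τ μ y (u (y + unitVec μ)) - u (y + unitVec μ)) + ((u (y + unitVec μ) - p) - (u y - p))‖ := by
          simp only [hD]; exact congrArg norm (by abel)
      _ ≤ ‖τ μ y (u (y + unitVec μ)) - u (y + unitVec μ)‖ + ‖(u (y + unitVec μ) - p) - (u y - p)‖ := norm_add_le _ _
      _ ≤ τ₀ + (‖u (y + unitVec μ) - p‖ + ‖u y - p‖) := add_le_add h1 (norm_sub_le _ _)
      _ ≤ τ₀ + (ω + ω) := by linarith [hω _ (hmem2p y hy μ), hω y (hmem2 y hy)]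
      _ ≤ 2 * ω' := by rw [hω']; linarith
  have hflat_fw : ∀ y ∈ box z R, ∀ μ, ‖u (y + unitVec μ) - u y‖ ≤ D y μ + τ₀ := fun y hy μ =>
    norm_sub_le_covD_add (τ μ y) (hdef y (hmem2 y hy) μ) (hu1 _ (hmem2p y hy μ))
  have hflat_bw : ∀ y ∈ box z R, ∀ μ, ‖u (y - unitVec μ) - u y‖ ≤ D (y - unitVec μ) μ + τ₀ := by
    intro y hy μ
    have h := norm_sub_le_covD_add' (τ μ (y - unitVec μ)) (hdef _ (hmem2m y hy μ) μ) (a := u (y - unitVec μ)) (hu1 y (hmem2 y hy))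
    simp only [hD, sub_add_cancel]; exact h
  have hSBP := sum_mul_lop 0 φ g z R hφ0
  simp only [zero_mul, add_zero] at hSBP
  have hL : ∑ y ∈ box z R, φ y * lop 0 g y = -∑ y ∈ box z R, χ y ^ 2 * (lam y * ⟪u y, p⟫_ℝ) - ∑ y ∈ box z R, χ y ^ 2 * ⟪Tw y, p⟫_ℝ := by
    rw [← Finset.sum_neg_distrib, ← Finset.sum_sub_distrib]
    refine Finset.sum_congr rfl fun y hy => ?_
    rw [hg, lop_oneSubInner_eq_twisted τ u y p (hu1 y (hmem2 y hy)) (hopt y (hRsub1 hy)), hφ, hlam, hTw]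
    ring
  have hlam_lb : ∀ y ∈ box z R, (1 / 2) * ∑ μ, D y μ ^ 2 ≤ lam y := by
    intro y hy
    rw [hlam, Finset.mul_sum]
    refine Finset.sum_le_sum fun μ _ => ?_
    have hτu : ‖τ μ y (u (y + unitVec μ))‖ = 1 := by rw [LinearIsometryEquiv.norm_map]; exact hu1 _ (hmem2p y hy μ)
    have hτu' : ‖(τ μ (y - unitVec μ)).symm (u (y - unitVec μ))‖ = 1 := by rw [LinearIsometryEquiv.norm_map]; exact hu1 _ (hmem2m y hy μ)
    have h1 := one_sub_inner_eq (hu1 y (hmem2 y hy)) hτu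
    have h2 := one_sub_inner_nonneg (hu1 y (hmem2 y hy)) hτu'
    rw [norm_sub_rev] at h1
    simp only [hD]; linarith
  have hLB : (1 / 4) * F ≤ ∑ y ∈ box z R, χ y ^ 2 * (lam y * ⟪u y, p⟫_ℝ) := by
    rw [hF, Finset.mul_sum]
    refine Finset.sum_le_sum fun y hy => ?_
    have hip : (1 / 2 : ℝ) ≤ ⟪u y, p⟫_ℝ := inner_ge_half (hu1 y (hmem2 y hy)) hp (hω y (hmem2 y hy)) (by linarith)
    have hl := hlam_lb y hy
    have hE0 : 0 ≤ ∑ μ, D y μ ^ 2 := Finset.sum_nonneg fun _ _ => sq_nonneg _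
    have hlam0 : 0 ≤ lam y := le_trans (by positivity) hl
    calc (1 / 4) * (χ y ^ 2 * ∑ μ, D y μ ^ 2) = χ y ^ 2 * (((1 / 2) * ∑ μ, D y μ ^ 2) * (1 / 2)) := by ring
      _ ≤ χ y ^ 2 * (lam y * ⟪u y, p⟫_ℝ) := mul_le_mul_of_nonneg_left (mul_le_mul hl hip (by norm_num) hlam0) (sq_nonneg _)
  have hbond : ∀ y ∈ box z R, ∀ μ : Fin d, -(fdiff μ φ y * fdiff μ g y) ≤
      (1 / 8) * (χ y ^ 2 * D y μ ^ 2) + (1 / 3 + 24) * (ω' ^ 2 / (s : ℝ) ^ 2) + (2 / s) * (ω' * τ₀) := by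
    intro y hy μ
    have huy := hu1 y (hmem2 y hy)
    have huy' := hu1 _ (hmem2p y hy μ)
    have hdg : |fdiff μ g y| ≤ ω' * (D y μ + τ₀) := by
      rw [fdiff_apply, hg]
      calc |(1 - ⟪u (y + unitVec μ), p⟫_ℝ) - (1 - ⟪u y, p⟫_ℝ)| ≤ ω * ‖u (y + unitVec μ) - u y‖ :=
            abs_sub_oneSubInner_le huy huy' (hω y (hmem2 y hy)) (hω _ (hmem2p y hy μ))
        _ ≤ ω' * (D y μ + τ₀) := mul_le_mul hωω' (hflat_fw y hy μ) (norm_nonneg _) hω'0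
    have hdφ : |fdiff μ φ y| ≤ (1 / s) * (χ (y + unitVec μ) + χ y) := by
      rw [fdiff_apply, hφ]
      have e : χ (y + unitVec μ) ^ 2 - χ y ^ 2 = (χ (y + unitVec μ) - χ y) * (χ (y + unitVec μ) + χ y) := by ring
      rw [e, abs_mul, abs_of_nonneg (add_nonneg (hχ0 _) (hχ0 _))]
      exact mul_le_mul_of_nonneg_right (hχlip y μ) (add_nonneg (hχ0 _) (hχ0 _))
    have hχsum : 0 ≤ χ (y + unitVec μ) + χ y := add_nonneg (hχ0 _) (hχ0 _)
    have hχsum2 : χ (y + unitVec μ) + χ y ≤ 2 := by linarith [hχ1 (y + unitVec μ), hχ1 y]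
    have hprod : -(fdiff μ φ y * fdiff μ g y) ≤ (1 / s) * (χ (y + unitVec μ) + χ y) * (ω' * D y μ) + (2 / s) * (ω' * τ₀) := by
      calc -(fdiff μ φ y * fdiff μ g y) ≤ |fdiff μ φ y| * |fdiff μ g y| := by rw [← abs_mul]; exact neg_le_abs _
        _ ≤ (1 / s) * (χ (y + unitVec μ) + χ y) * (ω' * (D y μ + τ₀)) := mul_le_mul hdφ hdg (abs_nonneg _) (by positivity)
        _ = (1 / s) * (χ (y + unitVec μ) + χ y) * (ω' * D y μ) + (1 / s) * (χ (y + unitVec μ) + χ y) * (ω' * τ₀) := by ring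
        _ ≤ (1 / s) * (χ (y + unitVec μ) + χ y) * (ω' * D y μ) + (1 / s) * 2 * (ω' * τ₀) := by
            have := mul_le_mul_of_nonneg_left hχsum2 (by positivity : (0:ℝ) ≤ (1 / s) * (ω' * τ₀))
            nlinarith [this]
        _ = (1 / s) * (χ (y + unitVec μ) + χ y) * (ω' * D y μ) + (2 / s) * (ω' * τ₀) := by ring
    have hχ' : χ (y + unitVec μ) ≤ χ y + 1 / s := by linarith [(abs_le.1 (hχlip y μ)).2]
    have hY := bond_young_le hs1 hω'0 (hDnn y μ) (hD2 y hy μ) hχ'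
    linarith
  have hMain : -(∑ y ∈ box z R, ∑ μ, fdiff μ φ y * fdiff μ g y) ≤
      (1 / 8) * F + ((1 / 3 + 24) * (ω' ^ 2 / (s : ℝ) ^ 2) + (2 / s) * (ω' * τ₀)) * (d * ((box z R).card : ℝ)) := by
    have h1 : -(∑ y ∈ box z R, ∑ μ, fdiff μ φ y * fdiff μ g y) = ∑ y ∈ box z R, ∑ μ, -(fdiff μ φ y * fdiff μ g y) := by
      rw [← Finset.sum_neg_distrib]; exact Finset.sum_congr rfl fun y _ => by rw [Finset.sum_neg_distrib]
    rw [h1]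
    have S1 : ∑ y ∈ box z R, ∑ μ : Fin d, (1 / 8) * (χ y ^ 2 * D y μ ^ 2) = (1 / 8) * F := by
      rw [hF, Finset.mul_sum]; exact Finset.sum_congr rfl fun y _ => by rw [Finset.mul_sum, Finset.mul_sum]
    have S2 : ∑ _y ∈ box z R, ∑ _μ : Fin d, ((1 / 3 + 24) * (ω' ^ 2 / (s : ℝ) ^ 2) + (2 / s) * (ω' * τ₀)) =
        ((1 / 3 + 24) * (ω' ^ 2 / (s : ℝ) ^ 2) + (2 / s) * (ω' * τ₀)) * (d * ((box z R).card : ℝ)) := by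
      simp only [Finset.sum_const, Finset.card_univ, Fintype.card_fin, nsmul_eq_mul]; ring
    calc ∑ y ∈ box z R, ∑ μ, -(fdiff μ φ y * fdiff μ g y)
        ≤ ∑ y ∈ box z R, ∑ μ : Fin d, ((1 / 8) * (χ y ^ 2 * D y μ ^ 2) + ((1 / 3 + 24) * (ω' ^ 2 / (s : ℝ) ^ 2) + (2 / s) * (ω' * τ₀))) :=
          Finset.sum_le_sum fun y hy => Finset.sum_le_sum fun μ _ => by linarith [hbond y hy μ]
      _ = _ := by rw [← S1, ← S2, ← Finset.sum_add_distrib]; exact Finset.sum_congr rfl fun y _ => Finset.sum_add_distrib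
  have hTw_pt : ∀ y ∈ box z R, |⟪Tw y, p⟫_ℝ| ≤ τ₁ + τ₀ * ∑ μ, ((D y μ + τ₀) + (D (y - unitVec μ) μ + τ₀)) := by
    intro y hy
    have hT := norm_twistSource_le τ u y (hu1 y (hmem2 y hy)) (fun μ => ⟨hdef y (hmem2 y hy) μ, hdef _ (hmem2m y hy μ) μ⟩) (hdiv y (hRsub1 hy))
    calc |⟪Tw y, p⟫_ℝ| ≤ ‖Tw y‖ * ‖p‖ := abs_real_inner_le_norm _ _
      _ = ‖Tw y‖ := by rw [hp, mul_one]
      _ ≤ τ₁ + τ₀ * ∑ μ, (‖u (y + unitVec μ) - u y‖ + ‖u (y - unitVec μ) - u y‖) := hT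
      _ ≤ τ₁ + τ₀ * ∑ μ, ((D y μ + τ₀) + (D (y - unitVec μ) μ + τ₀)) := by
          refine add_le_add le_rfl (mul_le_mul_of_nonneg_left (Finset.sum_le_sum fun μ _ => add_le_add (hflat_fw y hy μ) (hflat_bw y hy μ)) hτ₀)
  have hreidx : ∀ μ : Fin d, ∑ y ∈ box z R, χ y ^ 2 * D (y - unitVec μ) μ = ∑ y ∈ box z R, χ (y + unitVec μ) ^ 2 * D y μ := by
    intro μ
    have h := sum_box_shift_of_support (F := fun y => χ y ^ 2 * D (y - unitVec μ) μ) (z := z) (R := R)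
      (fun y hy => by simp only [hχ0R y hy]; ring) (unitVec μ) (abs_unitVec_apply_le μ)
    simp only [add_sub_cancel_right] at h
    rw [← h]
  have hTwSum : -(∑ y ∈ box z R, χ y ^ 2 * ⟪Tw y, p⟫_ℝ) ≤
      (1 / 16) * F + (τ₁ + 42 * d * τ₀ ^ 2 + 2 * d * τ₀ ^ 2 + (4 * d) * (τ₀ * ω') / (s : ℝ) ^ 2) * ((box z R).card : ℝ) := by
    have hpt : ∀ y ∈ box z R, -(χ y ^ 2 * ⟪Tw y, p⟫_ℝ) ≤
        (τ₁ + 2 * d * τ₀ ^ 2) + τ₀ * ∑ μ, (χ y ^ 2 * D y μ + χ y ^ 2 * D (y - unitVec μ) μ) := by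
      intro y hy
      have h1 : -(χ y ^ 2 * ⟪Tw y, p⟫_ℝ) ≤ χ y ^ 2 * |⟪Tw y, p⟫_ℝ| := by
        have hx : 0 ≤ ⟪Tw y, p⟫_ℝ + |⟪Tw y, p⟫_ℝ| := by linarith [neg_abs_le (⟪Tw y, p⟫_ℝ)]
        have := mul_nonneg (sq_nonneg (χ y)) hx
        linarith
      have hχ2 : χ y ^ 2 ≤ 1 := by have := hχ1 y; have := hχ0 y; nlinarith
      have h2 := mul_le_mul_of_nonneg_left (hTw_pt y hy) (sq_nonneg (χ y))
      have s1 : ∑ μ : Fin d, ((D y μ + τ₀) + (D (y - unitVec μ) μ + τ₀)) = ∑ μ, (D y μ + D (y - unitVec μ) μ) + 2 * d * τ₀ := by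
        have : ∑ μ : Fin d, ((D y μ + τ₀) + (D (y - unitVec μ) μ + τ₀)) = ∑ μ : Fin d, ((D y μ + D (y - unitVec μ) μ) + 2 * τ₀) :=
          Finset.sum_congr rfl fun μ _ => by ring
        rw [this, Finset.sum_add_distrib, Finset.sum_const, Finset.card_univ, Fintype.card_fin, nsmul_eq_mul]; ring
      have s2 : ∑ μ, (χ y ^ 2 * D y μ + χ y ^ 2 * D (y - unitVec μ) μ) = χ y ^ 2 * ∑ μ, (D y μ + D (y - unitVec μ) μ) := by
        rw [Finset.mul_sum]; exact Finset.sum_congr rfl fun μ _ => by ring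
      rw [s1] at h2
      rw [s2]
      have hS0 : 0 ≤ ∑ μ, (D y μ + D (y - unitVec μ) μ) := Finset.sum_nonneg fun μ _ => add_nonneg (hDnn _ _) (hDnn _ _)
      have h3 : χ y ^ 2 * (τ₁ + 2 * d * τ₀ ^ 2) ≤ τ₁ + 2 * d * τ₀ ^ 2 := mul_le_of_le_one_left (by positivity) hχ2
      have e4 : χ y ^ 2 * (τ₁ + τ₀ * (∑ μ, (D y μ + D (y - unitVec μ) μ) + 2 * d * τ₀)) =
          χ y ^ 2 * (τ₁ + 2 * d * τ₀ ^ 2) + τ₀ * (χ y ^ 2 * ∑ μ, (D y μ + D (y - unitVec μ) μ)) := by ring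
      rw [e4] at h2
      linarith
    have hsum1 : -(∑ y ∈ box z R, χ y ^ 2 * ⟪Tw y, p⟫_ℝ) ≤
        (τ₁ + 2 * d * τ₀ ^ 2) * ((box z R).card : ℝ) + τ₀ * ∑ μ, ∑ y ∈ box z R, (χ y ^ 2 + χ (y + unitVec μ) ^ 2) * D y μ := by
      rw [← Finset.sum_neg_distrib]
      calc ∑ y ∈ box z R, -(χ y ^ 2 * ⟪Tw y, p⟫_ℝ)
          ≤ ∑ y ∈ box z R, ((τ₁ + 2 * d * τ₀ ^ 2) + τ₀ * ∑ μ, (χ y ^ 2 * D y μ + χ y ^ 2 * D (y - unitVec μ) μ)) := Finset.sum_le_sum hpt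
        _ = (τ₁ + 2 * d * τ₀ ^ 2) * ((box z R).card : ℝ) + τ₀ * ∑ μ, ∑ y ∈ box z R, (χ y ^ 2 + χ (y + unitVec μ) ^ 2) * D y μ := by
            rw [Finset.sum_add_distrib, Finset.sum_const, nsmul_eq_mul, ← Finset.mul_sum, Finset.sum_comm]
            congr 1
            · ring
            · congr 1
              refine Finset.sum_congr rfl fun μ _ => ?_
              rw [Finset.sum_add_distrib, hreidx μ, ← Finset.sum_add_distrib]
              exact Finset.sum_congr rfl fun y _ => by ring
    have hY2 : ∀ y ∈ box z R, ∀ μ : Fin d, τ₀ * ((χ y ^ 2 + χ (y + unitVec μ) ^ 2) * D y μ) ≤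
        (1 / 16) * (χ y ^ 2 * D y μ ^ 2) + 36 * τ₀ ^ 2 + (4 / (s : ℝ) ^ 2) * (τ₀ * ω') := by
      intro y hy μ
      have hχ' : χ (y + unitVec μ) ≤ χ y + 1 / s := by linarith [(abs_le.1 (hχlip y μ)).2]
      exact twist_young_le hs1 hτ₀ (hχ0 y) (hχ1 y) (hχ0 _) hχ' (hDnn y μ) (hD2 y hy μ)
    have hsum2 : τ₀ * ∑ μ, ∑ y ∈ box z R, (χ y ^ 2 + χ (y + unitVec μ) ^ 2) * D y μ ≤
        (1 / 16) * F + (36 * τ₀ ^ 2 + (4 / (s : ℝ) ^ 2) * (τ₀ * ω')) * (d * ((box z R).card : ℝ)) := by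
      have e1 : ∑ y ∈ box z R, ∑ μ : Fin d, (1 / 16) * (χ y ^ 2 * D y μ ^ 2) = (1 / 16) * F := by
        rw [hF, Finset.mul_sum]; exact Finset.sum_congr rfl fun y _ => by rw [Finset.mul_sum, Finset.mul_sum]
      have e2 : ∑ _y ∈ box z R, ∑ _μ : Fin d, (36 * τ₀ ^ 2 + (4 / (s : ℝ) ^ 2) * (τ₀ * ω')) =
          (36 * τ₀ ^ 2 + (4 / (s : ℝ) ^ 2) * (τ₀ * ω')) * (d * ((box z R).card : ℝ)) := by
        simp only [Finset.sum_const, Finset.card_univ, Fintype.card_fin, nsmul_eq_mul]; ring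
      calc τ₀ * ∑ μ, ∑ y ∈ box z R, (χ y ^ 2 + χ (y + unitVec μ) ^ 2) * D y μ
          = ∑ y ∈ box z R, ∑ μ, τ₀ * ((χ y ^ 2 + χ (y + unitVec μ) ^ 2) * D y μ) := by
            rw [Finset.sum_comm, Finset.mul_sum]
            exact Finset.sum_congr rfl fun y _ => Finset.mul_sum _ _ _
        _ ≤ ∑ y ∈ box z R, ∑ μ : Fin d, ((1 / 16) * (χ y ^ 2 * D y μ ^ 2) + (36 * τ₀ ^ 2 + (4 / (s : ℝ) ^ 2) * (τ₀ * ω'))) :=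
            Finset.sum_le_sum fun y hy => Finset.sum_le_sum fun μ _ => by linarith [hY2 y hy μ]
        _ = (1 / 16) * F + (36 * τ₀ ^ 2 + (4 / (s : ℝ) ^ 2) * (τ₀ * ω')) * (d * ((box z R).card : ℝ)) := by
            rw [← e1, ← e2, ← Finset.sum_add_distrib]; exact Finset.sum_congr rfl fun y _ => Finset.sum_add_distrib
    have hcard0 : (0 : ℝ) ≤ ((box z R).card : ℝ) := Nat.cast_nonneg _
    have e3 : (τ₁ + 42 * d * τ₀ ^ 2 + 2 * d * τ₀ ^ 2 + (4 * d) * (τ₀ * ω') / (s : ℝ) ^ 2) * ((box z R).card : ℝ) =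
        (τ₁ + 2 * d * τ₀ ^ 2) * ((box z R).card : ℝ) + (36 * τ₀ ^ 2 + (4 / (s : ℝ) ^ 2) * (τ₀ * ω')) * (d * ((box z R).card : ℝ)) +
          6 * d * τ₀ ^ 2 * ((box z R).card : ℝ) := by ring
    rw [e3]
    have hextra : 0 ≤ 6 * d * τ₀ ^ 2 * ((box z R).card : ℝ) := by positivity
    linarith [hsum1, hsum2]
  have hmain : (1 / 4) * F ≤ (1 / 8) * F + ((1 / 3 + 24) * (ω' ^ 2 / (s : ℝ) ^ 2) + (2 / s) * (ω' * τ₀)) * (d * ((box z R).card : ℝ)) +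
      ((1 / 16) * F + (τ₁ + 42 * d * τ₀ ^ 2 + 2 * d * τ₀ ^ 2 + (4 * d) * (τ₀ * ω') / (s : ℝ) ^ 2) * ((box z R).card : ℝ)) := by
    have := hLB
    have e : ∑ y ∈ box z R, χ y ^ 2 * (lam y * ⟪u y, p⟫_ℝ) =
        -(∑ y ∈ box z R, ∑ μ, fdiff μ φ y * fdiff μ g y) + -(∑ y ∈ box z R, χ y ^ 2 * ⟪Tw y, p⟫_ℝ) := by linarith [hL, hSBP]
    rw [e] at this
    exact this.trans (add_le_add hMain hTwSum)
  have hcard : ((box z R).card : ℝ) = ((2 * (ρ + s + 1) + 1 : ℤ) : ℝ) ^ d := by rw [card_box z (by rw [hR]; linarith), hR]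
  have hcard0 : (0 : ℝ) ≤ ((box z R).card : ℝ) := Nat.cast_nonneg _
  have hF_le : F ≤ ((box z R).card : ℝ) * (448 * d * ω' ^ 2 / (s : ℝ) ^ 2 + 96 * d * (ω' * τ₀) / s + 16 * τ₁ + 704 * d * τ₀ ^ 2) :=
    assemble_twisted_le hs1 hcard0 hdR hω'0 hτ₀ hmain
  calc ∑ y ∈ box z ρ, ∑ μ, ‖τ μ y (u (y + unitVec μ)) - u y‖ ^ 2 = ∑ y ∈ box z ρ, χ y ^ 2 * ∑ μ, D y μ ^ 2 := by
        refine Finset.sum_congr rfl fun y hy => ?_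
        rw [hχin y (box_mono z (by linarith) hy), one_pow, one_mul]
    _ ≤ F := by
        rw [hF]
        exact Finset.sum_le_sum_of_subset_of_nonneg (box_mono z (by rw [hR]; linarith))
          fun y _ _ => mul_nonneg (sq_nonneg _) (Finset.sum_nonneg fun _ _ => sq_nonneg _)
    _ ≤ _ := by rw [hcard, hω'] at hF_le; exact hF_le

end Summit.QuantumFields.YangMills.Theorems.PoincareLipschitzSphereMapSmallRangeCaccioppoliTwisted

end
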